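/-
Origin: expansion seat `prover-pub-hodgecm-mc-binder-1-0`, handover #8 2026-08-18T18:53Z md5 155c50e3fbcabf896791d77d18cba75a (NEW, 173 l.; rewrites import McB1.IchinoFockKTypes -> HodgeCM.Literature.IchinoFockKTypes x1; also imports tree HodgeCM.PerL34.FockKTypes; audited names: HodgeCM.Model.Binders.IchinoExplicitRankOne.lemma_7_10_explicitRankOne, HodgeCM.Model.Binders.IchinoExplicitRankOne.isHWOne_iff) (`HOME/mc/pub-hodgecm-mc-binder-1/lean/McB1/IchinoExplicitRankOne.lean`, md5 155c50e3, 173 lines);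
landed by the packager successor (mc-unitary-1-g3, gen-8 kit) in gate run 32 as `HodgeCM/Model/Binders/IchinoExplicitRankOne.lean` (import ^import McB1\.IchinoFockKTypes[ \t]*$→import HodgeCM.Literature.IchinoFockKTypes ×1).
-/
/-
Copyright (c) 2026 the pub-hodgecm formalisation cell (harness21).  New file, not vendored.
Origin: HOME/mc/pub-hodgecm-mc-binder-1/lean/McB1/IchinoExplicitRankOne.lean — session prover-pub-hodgecm-mc-binder-1-0
(unit pub-hodgecm-mc-binder-1, MODEL-CONSTRUCTION sub-cell; MODEL-DAG node W3-K, the SIGN ANCHOR for W3-B).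
Intended final place: `HodgeCM/Model/Binders/IchinoExplicitRankOne.lean`.  Imports: the LANDED `HodgeCM.PerL34.FockKTypes`
(for pv12's `weightOp` API) and ONE rewrite `McB1.IchinoFockKTypes` ↦ `HodgeCM.Literature.IchinoFockKTypes`.
KIND: KERNEL; nothing cited as a hypothesis; nothing of PerL / QW8 / the 2001 programme used.
-/
import Summits.HodgeConjecture.HodgeCM.PerL34.FockKTypes
import Summits.HodgeConjecture.HodgeCM.Literature.IchinoFockKTypes

set_option autoImplicit false

/-!
# W3-K sign anchor: Ichino's Lemma 7.10 in the explicit Fock model `ℂ[z]` of the rank-one pair `(U(1), U(1))`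

For `(p,q;r,s) = (1,0;1,0)` — the dual pair `(U(W), U(V)) = (U(1), U(1)) ⊂ Sp₂(ℝ)` — the Fock model is `ℂ[z]`, both
compact groups act through the DEGREE (`𝔭′ = 0`: every vector is harmonic, no raising operators), and [Ich22] Lemma 7.10
reads: `z^a` carries `U(W)`-weight `a + 1/2 + m₀/2` and `U(V)`-weight `a + 1/2 + n₀/2` — POSITIVE in the degree on BOTH
sides.  This is the convention ANCHOR offered to W3-B (mc-period-1's interface memo Q1, STATUS 18:12:55Z): a realisation of
`ω_ψ|_{U(1)×U(1)}` in which both circles act on the degree-`a` Fock monomial by `+a` (plus the vacuum character) is in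
Ichino's sign (`ψ(x) = e^{−2π√−1x}`, §4.1); the tree's Folland-normalised `fockRep U F = F ∘ U⁻¹` (`−a`) is its conjugate.

* `explicitRankOne S : FockHarmonics S` — `corresponds μ μ′ :↔ ∃ a : ℕ, μ = a + (r−s)/2 + m₀/2 ∧ μ′ = a + (p−q)/2 + n₀/2`
  realised by the monomial `z^a` of `MvPolynomial Unit ℂ` (weights via pv12's `weightOp`);
* `isHWOne_iff` — the joint weight vectors are exactly `c·z^a`;
* **`lemma_7_10_explicitRankOne`** — Lemma 7.10 HOLDS for this model (`p = r = 1`, `q = s = 0`).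
-/

noncomputable section

namespace HodgeCM
namespace Model
namespace Binders
namespace IchinoExplicitRankOne

open MvPolynomial Finsupp
open HodgeCM.PerL34.Fock
open HodgeCM.Literature.Ichino2022 HodgeCM.Literature.Ichino2022.FockHarmonics
  HodgeCM.Literature.Ichino2022.HarmonicParam

/-- The rank-one Fock model `ℂ[z]`. -/
abbrev OneModel : Type := MvPolynomial Unit ℂ

/-- the degree weight (both `U(W) = U(1)` and `U(V) = U(1)` act through it). -/
def oneWt : Unit → ℤ := fun _ => 1

/-- (Ported verbatim from the HodgeCMPerL package; no docstring in the source.) -/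
theorem wt_oneWt (m : Unit →₀ ℕ) : wt oneWt m = (m () : ℤ) := by
  simp [wt, oneWt]

/-- **Joint weight vector of the rank-one model**: non-zero, of degree-weight `k` (= the `U(W)`- and the `U(V)`-weight
before the shifts; there are no raising operators and no `𝔭′⁻`). -/
structure IsHWOne (f : OneModel) (k : ℤ) : Prop where
  ne : f ≠ 0
  deg : weightOp oneWt f = (k : ℂ) • f

/-- **Classification**: the joint weight vectors are exactly `c·z^a`, `a ≥ 0`, of weight `a`. -/
theorem isHWOne_iff (f : OneModel) (k : ℤ) :
    IsHWOne f k ↔ ∃ (a : ℕ) (c : ℂ), c ≠ 0 ∧ f = c • (X () : OneModel) ^ a ∧ k = a := by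
  classical
  constructor
  · intro H
    have key : ∀ m ∈ f.support, (m () : ℤ) = k := by
      intro m hm
      have := wt_eq_of_weightOp_eq_smul H.deg hm
      rwa [wt_oneWt] at this
    obtain ⟨m₀, hm₀⟩ : ∃ m, m ∈ f.support := by
      by_contra hno
      apply H.ne
      ext m
      rw [coeff_zero]
      by_contra hne
      exact hno ⟨m, MvPolynomial.mem_support_iff.mpr hne⟩
    have hk : 0 ≤ k := by have := key m₀ hm₀; omega
    have hM : ∀ m ∈ f.support, m = single () k.toNat := by
      intro m hm
      apply Finsupp.unique_ext
      have := key m hm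
      rw [show (default : Unit) = () from rfl, single_eq_same]
      omega
    refine ⟨k.toNat, coeff (single () k.toNat) f, ?_, ?_, by omega⟩
    · intro h0
      apply (MvPolynomial.mem_support_iff.mp hm₀)
      rw [hM m₀ hm₀]; exact h0
    · rw [X_pow_eq_monomial, smul_monomial, smul_eq_mul, mul_one]
      ext m
      rw [coeff_monomial]
      by_cases hm : single () k.toNat = m
      · rw [if_pos hm, hm]
      · rw [if_neg hm]
        by_contra hne
        exact hm (hM m (MvPolynomial.mem_support_iff.mpr hne)).symm
  · rintro ⟨a, c, hc, rfl, rfl⟩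
    refine ⟨?_, ?_⟩
    · rw [X_pow_eq_monomial, smul_monomial, smul_eq_mul, mul_one, Ne, monomial_eq_zero]; exact hc
    · rw [X_pow_eq_monomial, smul_monomial, smul_eq_mul, mul_one, weightOp_monomial, wt_oneWt]
      simp

/-- **The [Ich22] dictionary of the rank-one model** for a datum with `(p,q;r,s) = (1,0;1,0)` (only `p = r = 1` is
used to name the single entries): `μ ⊠ μ′` corresponds iff a monomial `z^a` has the weights `(μ; μ′)` minus the
printed shifts `(r−s)/2 + m₀/2` and `(p−q)/2 + n₀/2`. -/
def explicitRankOne (S : SplittingDatum) : FockHarmonics S where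
  corresponds μ μ' := ∃ (f : OneModel) (k : ℤ), IsHWOne f k ∧
    (∀ i, μ.1 i = (k : ℚ) + ((S.r : ℚ) - S.s) / 2 + (S.m₀ : ℚ) / 2) ∧
    (∀ i, μ'.1 i = (k : ℚ) + ((S.p : ℚ) - S.q) / 2 + (S.n₀ : ℚ) / 2)

/-- **Ichino's Lemma 7.10 HOLDS in the rank-one model `ℂ[z]`** (`(p,q;r,s) = (1,0;1,0)`): BOTH circles act on `z^a` by
`+a` plus their vacuum characters — the SIGN ANCHOR of W3-K/W3-B. -/
theorem lemma_7_10_explicitRankOne (S : SplittingDatum) (hp : S.p = 1) (hq : S.q = 0) (hr : S.r = 1)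
    (hs : S.s = 0) : (explicitRankOne S).Lemma_7_10 := by
  intro μ μ'
  show (∃ (f : OneModel) (k : ℤ), IsHWOne f k ∧ _) ↔ _
  constructor
  · rintro ⟨f, k, hf, hμ, hμ'⟩
    obtain ⟨a, c, -, -, rfl⟩ := (isHWOne_iff f k).mp hf
    by_cases ha : a = 0
    · subst ha
      refine ⟨HarmonicParam.vacuum S, ?_, ?_⟩
      · rw [HarmonicParam.vacuum_mu]
        ext i
        · rw [hμ i]; push_cast; ring
        · exact (Fin.cast hq i).elim0
      · rw [HarmonicParam.vacuum_mu']
        ext i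
        · rw [hμ' i]; push_cast; ring
        · exact (Fin.cast hs i).elim0
    · have ha1 : 0 < (a : ℤ) := by omega
      let P : HarmonicParam S :=
        { pp := 1, pm := 0, qp := 0, qm := 0, a := fun _ => a, b := Fin.elim0, c := Fin.elim0, d := Fin.elim0
          a_anti := fun _ _ _ => le_rfl, b_anti := fun i => i.elim0, c_anti := fun i => i.elim0
          d_anti := fun i => i.elim0, a_pos := fun _ => ha1, b_neg := fun i => i.elim0
          c_pos := fun i => i.elim0, d_neg := fun i => i.elim0
          hp := by omega, hq := by omega, hr := by omega, hs := by omega }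
      refine ⟨P, ?_, ?_⟩
      · ext i
        · rw [hμ i, mu_fst_apply, pad_head _ _ _ _ (by show i.val < 1; omega)]
        · exact (Fin.cast hq i).elim0
      · ext i
        · rw [hμ' i, mu'_fst_apply, pad_head _ _ _ _ (by show i.val < 1; omega)]
        · exact (Fin.cast hs i).elim0
  · rintro ⟨P, hμ, hμ'⟩
    have hPq : P.qp + P.qm ≤ S.q := P.hq
    have hPs : P.pm + P.qp ≤ S.s := P.hs
    have hPp : P.pp + P.pm ≤ S.p := P.hp
    have hqm : P.qm = 0 := by omega
    have hqp : P.qp = 0 := by omega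
    have hpm : P.pm = 0 := by omega
    rcases Nat.lt_or_ge 0 P.pp with hpp | hpp
    · have ha := P.a_pos ⟨0, hpp⟩
      have hcast : (((P.a ⟨0, hpp⟩).toNat : ℤ) : ℚ) = (P.a ⟨0, hpp⟩ : ℚ) := by
        exact_mod_cast Int.toNat_of_nonneg ha.le
      refine ⟨_, _, (isHWOne_iff _ _).mpr ⟨(P.a ⟨0, hpp⟩).toNat, 1, one_ne_zero, rfl, rfl⟩, ?_, ?_⟩
      · intro i
        rw [hμ, mu_fst_apply, pad_head _ _ _ _ (by omega)]
        have : P.a ⟨i.val, by omega⟩ = P.a ⟨0, hpp⟩ := by congr 1; exact Fin.ext (by have := i.isLt; omega)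
        rw [this, hcast]
      · intro i
        rw [hμ', mu'_fst_apply, pad_head _ _ _ _ (by omega)]
        have : P.a ⟨i.val, by omega⟩ = P.a ⟨0, hpp⟩ := by congr 1; exact Fin.ext (by have := i.isLt; omega)
        rw [this, hcast]
    · have hpp0 : P.pp = 0 := by omega
      refine ⟨_, _, (isHWOne_iff _ _).mpr ⟨0, 1, one_ne_zero, rfl, rfl⟩, ?_, ?_⟩
      · intro i
        rw [hμ, mu_fst_apply, pad_mid _ _ _ _ (by omega) (by have := i.isLt; omega)]
        push_cast; ring
      · intro i
        rw [hμ', mu'_fst_apply, pad_mid _ _ _ _ (by omega) (by have := i.isLt; omega)]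
        push_cast; ring

end IchinoExplicitRankOne
end Binders
end Model
end HodgeCM
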